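import Summits.MatrixMultiplication.MatrixMultiplication.Theorems.AbelianSTPPCensusShapeCertVQDefsS
import Summits.MatrixMultiplication.MatrixMultiplication.Theorems.AbelianSTPPCensusShapeCertVQBudgetE

/-!
# Abelian STPP census — soundness of `ShapeCertVQ.checkQS`, part 1: the saturated-regime E3⁺ continuation budget is sound

Cell mm-stpp, rung F-M1; successor kernel item VQ-CERT (T_E beyond 337 under vQ := vP ∧ E3⁺) in support of the closed crux item
stmt-MatrixMultiplication-19191; seat mm-stpp-vp-p2 (gen 2).
* `e3pL_ge_sat` — on the whole exact regime `σ' = s_A + s_B + s_C ≤ V` of `STPPThreeRoomEnergy.e3pL` (sides `≥ 1`, `mp` dominating the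
  three pair-sums of sides and twice the least side, `mp ≤ M + 1`):  `V(2m₀ − 1) + (M + 1 − mp)(V − σ') ≤ e3pL`.
* `budgetS_core` — hence tail letter masses `U_X ≤ s_X` that keep the member E3⁺-alive have total
  `≤ (σ − V) + (V² − V(2m₀ − 1)) / (M + 1 − mp)` (trivially so while the family's slacks stay saturated, `σ − ΣU > V`).
* **`AboveQ.tail_uu_le_qSOfT`** / **`AboveQ.tail_uu_le_qS`** — the budget `qSOfT` / `qSOf` of `…DefsS` bounds the tail packing mass of
  every vQ-admissible family above the prefix (rule U14 bounds the tail's letter sums by the slacks, `AboveQ.tail_pbc/pca/pab`, exactly as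
  in g1's `AboveQ.tail_uu_le_qEOfT`); **`AboveQ.tail_uu_le_qOfS`** — so does the node budget `qOfS = min q0 (min qE qS)`.
* The blocked pool: `candBQ_flatten` (its flattening is `candQ M`), `candBQ_const` (blocks are level-constant), `PoolOKQ.sublist`.
* Facts for the candidate step: `AboveQ.not_beat_of_first_S` (the first-member bound with the rest budget `q − uu(t)`, after
  `…BudgetE.AboveQ.not_beat_of_first_q`), `tail_uu_cons`, `AboveQ.not_mem_of_skipS` (a skipped candidate is no tail member).
Part 2 (`…ShapeCertVQSearchS`): the search induction, `checkQS_sound`; part 3 (`…ShapeCertVQSearchPS`): path segments.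
-/

set_option linter.dupNamespace false -- `MatrixMultiplication.MatrixMultiplication` (summit = problem, D-0017)
set_option autoImplicit false

namespace Summit.MatrixMultiplication.MatrixMultiplication.Theorems.ShapeCertVQ

open ShapeCert ShapeCertVP STPPThreeRoomEnergy Multiset

section budgetS
/-! ### The saturated-regime E3⁺ continuation budget is sound -/

variable {M : ℕ} {G : Multiset (ℕ × ℕ × ℕ)} {fam : List Sh}

/-- **the pointwise lower bound of `e3pL` on the exact regime**: `V(2m₀ − 1) + (M + 1 − mp)(V − σ') ≤ e3pL` whenever
`σ' = s_A + s_B + s_C ≤ V`, the sides are `≥ m₀ ≥ 1`, `mp` dominates the three sums of two sides and `2m₀`, and `mp ≤ M + 1` -/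
theorem e3pL_ge_sat {M V x y z sA sB sC mp m0 : ℕ} (hσ : sA + sB + sC ≤ V) (h0 : 1 ≤ m0) (hx : m0 ≤ x) (hy : m0 ≤ y) (hz : m0 ≤ z)
    (hmA : y + z ≤ mp) (hmB : x + z ≤ mp) (hmC : x + y ≤ mp) (hm0 : 2 * m0 ≤ mp) (hM : mp ≤ M + 1) :
    V * (2 * m0 - 1) + (M + 1 - mp) * (V - (sA + sB + sC)) ≤ e3pL M V x y z sA sB sC := by
  rw [e3pL_eq_of_le hσ]
  obtain ⟨d, rfl⟩ : ∃ d, V = sA + sB + sC + d := ⟨V - (sA + sB + sC), by omega⟩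
  obtain ⟨k, rfl⟩ : ∃ k, m0 = k + 1 := ⟨m0 - 1, by omega⟩
  obtain ⟨x', rfl⟩ : ∃ x', x = k + 1 + x' := ⟨x - (k + 1), by omega⟩
  obtain ⟨y', rfl⟩ : ∃ y', y = k + 1 + y' := ⟨y - (k + 1), by omega⟩
  obtain ⟨z', rfl⟩ : ∃ z', z = k + 1 + z' := ⟨z - (k + 1), by omega⟩
  obtain ⟨e, rfl⟩ : ∃ e, mp = 2 * (k + 1) + e := ⟨mp - 2 * (k + 1), by omega⟩
  obtain ⟨f, hf⟩ : ∃ f, M + 1 = 2 * (k + 1) + e + f := ⟨M + 1 - (2 * (k + 1) + e), by omega⟩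
  have hM' : M = 2 * k + 1 + e + f := by omega
  subst hM'
  have e1 : sA + sB + sC + d - (sA + sB + sC) = d := by omega
  have e2 : 2 * k + 1 + e + f + 1 - (2 * (k + 1) + e) = f := by omega
  have e3 : 2 * (k + 1) - 1 = 2 * k + 1 := by omega
  have e4 : k + 1 + x' - 1 = k + x' := by omega
  have e5 : k + 1 + y' - 1 = k + y' := by omega
  have e6 : k + 1 + z' - 1 = k + z' := by omega
  rw [e1, e2, e3, e4, e5, e6]
  have key : (2 * k + 1 + e + f) * d + (sA + sB + sC) + (k + x') * (sB + sC) + (k + y') * (sA + sC) + (k + z') * (sA + sB) =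
      (sA + sB + sC + d) * (2 * k + 1) + f * d + (e * d + x' * (sB + sC) + y' * (sA + sC) + z' * (sA + sB)) := by ring
  rw [key]
  exact Nat.le_add_right _ _

/-- **the arithmetic core of the budget**: tail letter masses `U_X ≤ s_X` keeping `e3pL(s − U) ≤ V²` have total mass
`≤ (σ − V) + (V² − V(2m₀ − 1)) / (M + 1 − mp)` (`σ = s_A + s_B + s_C`, any regime of the prefix) -/
theorem budgetS_core {M V x y z sA sB sC UA UB UC mp m0 : ℕ}
    (uA : UA ≤ sA) (uB : UB ≤ sB) (uC : UC ≤ sC) (h0 : 1 ≤ m0) (hx : m0 ≤ x) (hy : m0 ≤ y) (hz : m0 ≤ z)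
    (hmA : y + z ≤ mp) (hmB : x + z ≤ mp) (hmC : x + y ≤ mp) (hm0 : 2 * m0 ≤ mp) (hc : 0 < M + 1 - mp)
    (hadm : e3pL M V x y z (sA - UA) (sB - UB) (sC - UC) ≤ V * V) :
    UA + UB + UC ≤ (sA + sB + sC - V) + (V * V - V * (2 * m0 - 1)) / (M + 1 - mp) := by
  by_cases hsat : V < (sA - UA) + (sB - UB) + (sC - UC)
  · -- the family's slacks are still saturated: the tail mass is below `σ − V`
    have : UA + UB + UC ≤ sA + sB + sC - V := by omega
    exact this.trans (Nat.le_add_right _ _)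
  · -- exact regime for the family: the pointwise bound
    have hσ' : (sA - UA) + (sB - UB) + (sC - UC) ≤ V := by omega
    have hge := e3pL_ge_sat (M := M) (x := x) (y := y) (z := z) hσ' h0 hx hy hz hmA hmB hmC hm0 (by omega)
    have h1 : (M + 1 - mp) * (V - ((sA - UA) + (sB - UB) + (sC - UC))) ≤ V * V - V * (2 * m0 - 1) := by omega
    have h2 : V - ((sA - UA) + (sB - UB) + (sC - UC)) ≤ (V * V - V * (2 * m0 - 1)) / (M + 1 - mp) := by
      rw [Nat.le_div_iff_mul_le hc, Nat.mul_comm]; exact h1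
    have h3 : UA + UB + UC ≤ (sA + sB + sC - V) + (V - ((sA - UA) + (sB - UB) + (sC - UC))) := by omega
    exact h3.trans (Nat.add_le_add_left h2 _)

/-- what a defined member budget says (the conditions of `qSOfT` and its value) -/
theorem qSOfT_spec {M : ℕ} {A : Agg} {t : Sh} {b : ℕ} (hb : qSOfT M A t = some b) :
    M < 2 * t.V ∧ t.V + (A.sbc - t.bc) ≤ M ∧ t.V + (A.sca - t.ca) ≤ M ∧ t.V + (A.sab - t.ab) ≤ M ∧
    0 < M + 1 - mpS t ∧
    b = ((M - t.V - (A.sbc - t.bc)) + (M - t.V - (A.sca - t.ca)) + (M - t.V - (A.sab - t.ab)) - t.V) +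
      (t.V * t.V - t.V * (2 * min t.a (min t.b t.c) - 1)) / (M + 1 - mpS t) := by
  unfold qSOfT at hb
  simp only [seqN_eq] at hb
  split_ifs at hb with c1 c2
  rw [Option.some.injEq] at hb
  exact ⟨c1.1, c1.2.1, c1.2.2.1, c1.2.2.2, c2, hb.symm⟩

/-- **the saturated-regime E3⁺ continuation budget of one prefix member is sound**: the tail packing mass of every vQ-admissible
family above the prefix is at most `qSOfT` of any prefix member for which it is defined (after g1's `AboveQ.tail_uu_le_qEOfT`, with
`budgetS_core` in place of `budget_core`) -/
theorem AboveQ.tail_uu_le_qSOfT (h : AboveQ M G fam) {t : Sh} (ht : t ∈ fam) {b : ℕ}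
    (hb : qSOfT M (aggOf M fam) t = some b) : ((G - famT fam).map uu).sum ≤ b := by
  obtain ⟨h2V, hA, hB, hC, hc, rfl⟩ := qSOfT_spec hb
  have wt := h.wf t ht
  have hxF : t.tr ∈ famT fam := tr_mem_famT ht
  have hxG : t.tr ∈ G := h.mem_G ht
  have ea := congrArg Sh.a wt; have eb := congrArg Sh.b wt; have ec := congrArg Sh.c wt; have ev := congrArg Sh.V wt
  have eab := congrArg Sh.ab wt; have ebc := congrArg Sh.bc wt; have eca := congrArg Sh.ca wt
  have edbc := congrArg Sh.dbc wt; have edca := congrArg Sh.dca wt; have edab := congrArg Sh.dab wt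
  rw [shQ_a] at ea; rw [shQ_b] at eb; rw [shQ_c] at ec; rw [shQ_V] at ev
  rw [shQ_ab] at eab; rw [shQ_bc] at ebc; rw [shQ_ca] at eca
  rw [shQ_dbc] at edbc; rw [shQ_dca] at edca; rw [shQ_dab] at edab
  -- the prefix's off-member sums at `t`
  have fbc : sbc fam = t.bc + ((aggOf M fam).sbc - t.bc) := by
    have hle : pbc t.tr ≤ ((famT fam).map pbc).sum := Multiset.le_sum_of_mem (Multiset.mem_map_of_mem pbc hxF)
    show sbc fam = t.bc + (sbc fam - t.bc); rw [sbc_eqQ h.wf, ebc]; omega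
  have fca : sca fam = t.ca + ((aggOf M fam).sca - t.ca) := by
    have hle : pca t.tr ≤ ((famT fam).map pca).sum := Multiset.le_sum_of_mem (Multiset.mem_map_of_mem pca hxF)
    show sca fam = t.ca + (sca fam - t.ca); rw [sca_eqQ h.wf, eca]; omega
  have fab : sab fam = t.ab + ((aggOf M fam).sab - t.ab) := by
    have hle : pab t.tr ≤ ((famT fam).map pab).sum := Multiset.le_sum_of_mem (Multiset.mem_map_of_mem pab hxF)
    show sab fam = t.ab + (sab fam - t.ab); rw [sab_eqQ h.wf, eab]; omega
  -- abbreviations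
  generalize hSA : (aggOf M fam).sbc - t.bc = SA at hA fbc
  generalize hSB : (aggOf M fam).sca - t.ca = SB at hB fca
  generalize hSC : (aggOf M fam).sab - t.ab = SC at hC fab
  -- the tail's letter sums are at most the slacks (rule U14 with the member's own offsets)
  have tA := h.tail_pbc; have tB := h.tail_pca; have tC := h.tail_pab
  have dB : t.dbc ≤ dBC fam :=
    Literature.Computability.AlgebraicComplexity.ArithCircuit.le_foldr_max_of_mem (List.mem_map.mpr ⟨t, ht, rfl⟩)
  have dC : t.dca ≤ dCA fam :=
    Literature.Computability.AlgebraicComplexity.ArithCircuit.le_foldr_max_of_mem (List.mem_map.mpr ⟨t, ht, rfl⟩)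
  have dA : t.dab ≤ dAB fam :=
    Literature.Computability.AlgebraicComplexity.ArithCircuit.le_foldr_max_of_mem (List.mem_map.mpr ⟨t, ht, rfl⟩)
  have hdbc : vol t.tr - pbc t.tr ≤ t.dbc := by rw [edbc]; exact Nat.le_add_right _ _
  have hdca : vol t.tr - pca t.tr ≤ t.dca := by rw [edca]; exact Nat.le_add_right _ _
  have hdab : vol t.tr - pab t.tr ≤ t.dab := by rw [edab]; exact Nat.le_add_right _ _
  have pbcV : pbc t.tr ≤ vol t.tr := (h.univ _ hxG).pbc_le_vol
  have pcaV : pca t.tr ≤ vol t.tr := (h.univ _ hxG).pca_le_vol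
  have pabV : pab t.tr ≤ vol t.tr := (h.univ _ hxG).pab_le_vol
  have uA : ((G - famT fam).map pbc).sum ≤ M - t.V - SA := by rw [ev]; omega
  have uB : ((G - famT fam).map pca).sum ≤ M - t.V - SB := by rw [ev]; omega
  have uC : ((G - famT fam).map pab).sum ≤ M - t.V - SC := by rw [ev]; omega
  -- the family's off-member sums at `t` and its E3⁺ condition there
  have gA : ((G.erase t.tr).map pbc).sum = SA + ((G - famT fam).map pbc).sum := by
    have := h.erase_split ht pbc; rw [← sbc_eqQ h.wf, fbc, ebc] at this; omega
  have gB : ((G.erase t.tr).map pca).sum = SB + ((G - famT fam).map pca).sum := by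
    have := h.erase_split ht pca; rw [← sca_eqQ h.wf, fca, eca] at this; omega
  have gC : ((G.erase t.tr).map pab).sum = SC + ((G - famT fam).map pab).sum := by
    have := h.erase_split ht pab; rw [← sab_eqQ h.wf, fab, eab] at this; omega
  have hadm := h.admE t.tr hxG (by rw [← ev]; exact h2V)
  rw [gA, gB, gC] at hadm
  generalize hUA : ((G - famT fam).map pbc).sum = UA at uA hadm
  generalize hUB : ((G - famT fam).map pca).sum = UB at uB hadm
  generalize hUC : ((G - famT fam).map pab).sum = UC at uC hadm
  -- the family's `e3pLHS` in slack variables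
  have hLHS : e3pLHS M t.tr.1 t.tr.2.1 t.tr.2.2 (SA + UA) (SB + UB) (SC + UC) =
      e3pL M t.V t.a t.b t.c (M - t.V - SA - UA) (M - t.V - SB - UB) (M - t.V - SC - UC) := by
    unfold e3pLHS
    have e0 : t.tr.1 * t.tr.2.1 * t.tr.2.2 = t.V := by rw [ev]; rfl
    rw [e0, ea, eb, ec]
    have q1 : M - (t.V + (SA + UA)) = M - t.V - SA - UA := by omega
    have q2 : M - (t.V + (SB + UB)) = M - t.V - SB - UB := by omega
    have q3 : M - (t.V + (SC + UC)) = M - t.V - SC - UC := by omega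
    rw [q1, q2, q3]
  rw [hLHS, sq, ev] at hadm
  obtain ⟨p1, p2, p3, -⟩ := InUniv.sides_vol (h.univ _ hxG)
  have core := budgetS_core (M := M) (V := t.V) (x := t.a) (y := t.b) (z := t.c) (mp := mpS t)
    (m0 := min t.a (min t.b t.c)) (sA := M - t.V - SA) (sB := M - t.V - SB) (sC := M - t.V - SC) uA uB uC
    (by rw [ea, eb, ec]; omega) (min_le_left _ _) ((min_le_right _ _).trans (min_le_left _ _))
    ((min_le_right _ _).trans (min_le_right _ _))
    (by unfold mpS; omega) (by unfold mpS; omega) (by unfold mpS; omega) (by unfold mpS; omega) hc (by rw [ev]; exact hadm)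
  rw [sum_uu_eq, hUA, hUB, hUC]
  have e : UC + UA + UB = UA + UB + UC := by ring
  rw [e]
  exact core

/-- **the saturated-regime E3⁺ continuation budget of a prefix is sound**: if the tail mass is at most `q` it is at most `qSOf … q` -/
theorem AboveQ.tail_uu_le_qS (h : AboveQ M G fam) {q : ℕ} (hq : ((G - famT fam).map uu).sum ≤ q) :
    ((G - famT fam).map uu).sum ≤ qSOf M (aggOf M fam) fam q := by
  unfold qSOf
  suffices H : ∀ l : List Sh, (∀ t ∈ l, t ∈ fam) →
      ((G - famT fam).map uu).sum ≤ l.foldr (fun t acc => match qSOfT M (aggOf M fam) t with | none => acc | some b => min acc b) q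
    from H fam (fun t ht => ht)
  intro l hl
  induction l with
  | nil => simpa using hq
  | cons t l ih =>
    rw [List.foldr_cons]
    have ih' := ih (fun s hs => hl s (List.mem_cons_of_mem _ hs))
    cases hqt : qSOfT M (aggOf M fam) t with
    | none => simpa using ih'
    | some b =>
      exact le_min ih' (h.tail_uu_le_qSOfT (hl t (by simp)) hqt)

/-- **the node budget of `checkQS` is sound**: the tail packing mass of every vQ-admissible family above the prefix is at most
`qOfS` (eng-2's `q0` by `AboveQ.tail_uu`, g1's `qE` by `AboveQ.tail_uu_le_qE`, `qS` by `AboveQ.tail_uu_le_qS`) -/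
theorem AboveQ.tail_uu_le_qOfS (h : AboveQ M G fam) : ((G - famT fam).map uu).sum ≤ qOfS M (aggOf M fam) fam :=
  h.tail_uu_le_qS (h.tail_uu_le_qE h.tail_uu)

end budgetS

section pool
/-! ### Pools: flattening, suffixes, the blocked candidate pool -/

variable {M : ℕ}

/-- a good pool stays good when members are removed (any sublist) -/
theorem PoolOKQ.sublist {R R' : List Sh} (h : PoolOKQ M R) (hs : R'.Sublist R) : PoolOKQ M R' :=
  ⟨fun s hs' => h.wf s (hs.subset hs'), fun s hs' => h.univ s (hs.subset hs'), h.sorted.sublist hs⟩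

/-- dropping the head block keeps the pool good -/
theorem PoolOKQ.dropBlock {b : List Sh} {bs : List (List Sh)} (h : PoolOKQ M (b ++ bs.flatten)) : PoolOKQ M bs.flatten :=
  h.sublist (List.sublist_append_right b _)

/-- the levels of the candidate blocks -/
theorem mem_levelsQ {L : ℕ} (h : L ∈ levelsQ) : 12 ≤ L ∧ L ≤ 58 := by
  unfold levelsQ at h
  rw [List.mem_map] at h
  obtain ⟨i, hi, rfl⟩ := h
  rw [List.mem_range] at hi
  omega

/-- members of a block have the block's level -/
theorem blockQ_lev {L : ℕ} (hL : L ≤ 58) {s : Sh} (hs : s ∈ blockQ M L) : s.lev = L := by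
  unfold blockQ at hs
  rw [List.mem_filterMap] at hs
  obtain ⟨x, hx, h⟩ := hs
  by_cases hin : inUnivB M x.1 x.2.1 x.2.2 = true
  · rw [if_pos hin, Sh.force_eq, Option.some.injEq] at h
    have e : s = shQ M x := by rw [← h]; rfl
    rw [e, shQ_lev]
    exact litLevQ_lev L (by omega) x hx
  · rw [if_neg hin] at h; exact absurd h (by simp)

/-- **the candidate blocks are level-constant** -/
theorem candBQ_const (M : ℕ) : ∀ b ∈ candBQ M, ∀ s ∈ b, ∀ s' ∈ b, s.lev = s'.lev := by
  intro b hb s hs s' hs'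
  unfold candBQ at hb
  rw [List.mem_map] at hb
  obtain ⟨L, hL, rfl⟩ := hb
  have hL' := (mem_levelsQ hL).2
  rw [blockQ_lev hL' hs, blockQ_lev hL' hs']

/-- the block levels, explicitly -/
theorem levelsQ_eq : levelsQ = [58, 57, 56, 55, 54, 53, 52, 51, 50, 49, 48, 47, 46, 45, 44, 43, 42, 41, 40, 39, 38, 37, 36, 35,
    34, 33, 32, 31, 30, 29, 28, 27, 26, 25, 24, 23, 22, 21, 20, 19, 18, 17, 16, 15, 14, 13, 12] := by decide

/-- `filterMap` over the concatenated level lists is the concatenation of the blocks -/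
theorem candBQ_flatten (M : ℕ) : (candBQ M).flatten = candQ M := by
  rw [candBQ, levelsQ_eq]
  simp only [List.map_cons, List.map_nil, List.flatten_cons, List.flatten_nil, List.append_nil]
  unfold candQ candTriplesQ blockQ
  simp only [List.filterMap_append, List.append_assoc]

end pool

section stepfacts
/-! ### Facts for the candidate step: the first-member bound with the rest budget, skipped candidates -/

variable {M : ℕ}

/-- **first-member bound with the rest budget**: as `AboveQ.not_beat_of_first_q`, the child's tail mass bounded by `qr` directly -/
theorem AboveQ.not_beat_of_first_S {G : Multiset (ℕ × ℕ × ℕ)} {fam : List Sh} (h : AboveQ M G fam) {t : Sh}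
    (ht : t.tr ∈ G - famT fam) (hwt : t = shQ M t.tr) (hL : ∀ x ∈ G - famT fam, levTQ x ≤ loLev ∨ levTQ x ≤ t.lev) {qr : ℕ}
    (hq : ((G - famT (t :: fam)).map uu).sum ≤ qr)
    (hle : gs fam * K + t.g * K + selOf ((aggOf M fam).kOf M) (tabRQ t.lev) *
      min qr ((3 * M + (t.a + t.b + t.c)) / 2 - uuA (aggOf M fam) - (t.ab + t.bc + t.ca)) ≤ M * D * K) :
    ¬ M * D < gsumQ G := by
  intro hbeat
  have hle1 : famT (t :: fam) ≤ G := cons_le_of_mem_sub h.le ht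
  have hwf1 : WfQ M (t :: fam) := by
    intro s hs; rcases List.mem_cons.mp hs with rfl | hs
    · exact hwt
    · exact h.wf s hs
  have h1 : AboveQ M G (t :: fam) := ⟨h.hM, h.univ, h.adm, h.admG, h.admE, hwf1, hle1⟩
  have hsplit := h1.gsum_split
  have hgs : gs (t :: fam) = t.g + gs fam := rfl
  have hsub : G - famT (t :: fam) ≤ G - famT fam := sub_cons_le _ _ _
  have hB : ∀ x ∈ G - famT (t :: fam), gTQ x * K ≤ selOf ((aggOf M fam).kOf M) (tabRQ t.lev) * uu x := by
    intro x hx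
    have hx' : x ∈ G - famT fam := Multiset.mem_of_le hsub hx
    have hU := h.univ x (mem_G_of_tail hx')
    rw [selOf_eq]
    exact (gTQ_mul_le_rho hU).trans (Nat.mul_le_mul_right _ (rhoTQ_le_tabRQ' h.hM hU (hL x hx') (h.tail_capOK hx')))
  have hgT : gsumQ (G - famT (t :: fam)) * K ≤
      selOf ((aggOf M fam).kOf M) (tabRQ t.lev) * ((G - famT (t :: fam)).map uu).sum := by
    unfold gsumQ; rw [← Multiset.sum_map_mul_right, ← Multiset.sum_map_mul_left]
    exact Multiset.sum_map_le_sum_map _ _ hB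
  have hq2 : ((G - famT (t :: fam)).map uu).sum ≤
      (3 * M + (t.a + t.b + t.c)) / 2 - uuA (aggOf M fam) - (t.ab + t.bc + t.ca) := by
    have h2 := two_sum_uu_le h.adm (mem_G_of_tail ht)
    rw [sum_map_split hle1 uu] at h2
    have ef : ((famT (t :: fam)).map uu).sum = uu t.tr + ((famT fam).map uu).sum := by
      rw [famT_cons]; simp
    rw [ef, ← uuA_aggOfQ h.wf] at h2
    have e1 : t.a = t.tr.1 := rfl
    have e2 : t.b = t.tr.2.1 := rfl
    have e3 : t.c = t.tr.2.2 := rfl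
    have e4 : t.ab + t.bc + t.ca = uu t.tr := by
      rw [hwt]; simp [uu]
    have h3 : uu t.tr + uuA (aggOf M fam) + ((G - famT (t :: fam)).map uu).sum ≤
        (3 * M + (t.tr.1 + t.tr.2.1 + t.tr.2.2)) / 2 := by
      rw [Nat.le_div_iff_mul_le (by norm_num)]; omega
    rw [e1, e2, e3, e4]; omega
  have hq' : ((G - famT (t :: fam)).map uu).sum ≤
      min qr ((3 * M + (t.a + t.b + t.c)) / 2 - uuA (aggOf M fam) - (t.ab + t.bc + t.ca)) := le_min hq hq2
  have : gsumQ G * K ≤ M * D * K := by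
    rw [hsplit, hgs]
    calc (t.g + gs fam + gsumQ (G - famT (t :: fam))) * K
        = gs fam * K + t.g * K + gsumQ (G - famT (t :: fam)) * K := by ring
      _ ≤ gs fam * K + t.g * K + selOf ((aggOf M fam).kOf M) (tabRQ t.lev) *
          min qr ((3 * M + (t.a + t.b + t.c)) / 2 - uuA (aggOf M fam) - (t.ab + t.bc + t.ca)) :=
          Nat.add_le_add_left (hgT.trans (Nat.mul_le_mul_left _ hq')) _
      _ ≤ M * D * K := hle
  have := Nat.le_of_mul_le_mul_right this (show 0 < K by decide)
  omega

/-- the tail of the extended prefix is the tail minus the new member: its packing mass drops by `uu(t)` -/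
theorem tail_uu_cons {G : Multiset (ℕ × ℕ × ℕ)} {fam : List Sh} {t : Sh} (ht : t.tr ∈ G - famT fam) :
    ((G - famT (t :: fam)).map uu).sum = ((G - famT fam).map uu).sum - uu t.tr := by
  have e : G - famT (t :: fam) = (G - famT fam).erase t.tr := by
    rw [famT_cons, ← Multiset.singleton_add, add_comm, tsub_add_eq_tsub_tsub, Multiset.sub_singleton]
  rw [e]; exact (erase_sum_eq ht uu).symm

/-- a skipped candidate is no tail member (volume cap, packing budget, the three U11 budgets) -/
theorem AboveQ.not_mem_of_skipS {G : Multiset (ℕ × ℕ × ℕ)} {fam : List Sh} (hG : AboveQ M G fam) {t : Sh}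
    (hwt : t = shQ M t.tr) {q : ℕ} (hq : ((G - famT fam).map uu).sum ≤ q)
    (hs : skipS t ((aggOf M fam).ra M) ((aggOf M fam).rb M) ((aggOf M fam).rc M) ((aggOf M fam).vl M) q = true) :
    t.tr ∉ G - famT fam := by
  intro hx
  have hU := hG.univ _ (mem_G_of_tail hx)
  have w1 := Multiset.le_sum_of_mem (Multiset.mem_map_of_mem wa hx)
  have w2 := Multiset.le_sum_of_mem (Multiset.mem_map_of_mem wb hx)
  have w3 := Multiset.le_sum_of_mem (Multiset.mem_map_of_mem wc hx)
  have w4 := Multiset.le_sum_of_mem (Multiset.mem_map_of_mem uu hx)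
  have t1 := hG.tail_wa; have t2 := hG.tail_wb; have t3 := hG.tail_wc
  obtain ⟨v1, v2, v3, v4⟩ := hG.tail_vol hx
  have ea := congrArg Sh.wA hwt; have eb := congrArg Sh.wB hwt; have ec := congrArg Sh.wC hwt
  have ev := congrArg Sh.V hwt
  have eab := congrArg Sh.ab hwt; have ebc := congrArg Sh.bc hwt; have eca := congrArg Sh.ca hwt
  rw [shQ_wA] at ea; rw [shQ_wB] at eb; rw [shQ_wC] at ec; rw [shQ_V] at ev
  rw [shQ_ab] at eab; rw [shQ_bc] at ebc; rw [shQ_ca] at eca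
  have hut : t.ab + t.bc + t.ca = uu t.tr := by rw [eab, ebc, eca]; rfl
  unfold skipS at hs
  unfold Agg.ra Agg.rb Agg.rc Agg.vl Agg.mc aggOf at hs
  simp only [Bool.or_eq_true, decide_eq_true_eq] at hs
  have hm : max (max (sab fam) (max (sbc fam) (sca fam))) (mxP fam) ≤ M - vol t.tr :=
    max_le (max_le (by omega) (max_le (by omega) (by omega))) (by omega)
  rw [hut] at hs
  omega

end stepfacts

end Summit.MatrixMultiplication.MatrixMultiplication.Theorems.ShapeCertVQ
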